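import Summits.BirchSwinnertonDyer.Rank1Residual.Partition.MainConjecturesIrreducibleBDPThree
import Summits.BirchSwinnertonDyer.Rank1Residual.Partition.MainConjecturesIrreducibleClass
import Summits.BirchSwinnertonDyer.Rank1Residual.Partition.TamagawaHeegnerAnyPrime
import HarnessLib

/-!
# The Tamagawa proviso of the irreducible rank-one rows is NOT NEEDED: the TWO-SIDED anticyclotomic
# main conjecture (BCS 2025 Thm. 1.2.4 (b) / Yan–Zhu 2026 Thm. 4.12, as vendored) + JSW 2017 Thm. 3.3.1
# give the Heegner-index IDENTITY over `K` directly — no Kolyvagin index bound, no Jetchev, no `K″`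
# (cell `b2b-bsdres`, GLUE seat gen 9; generic layer)

HONEST FRAMING (cell `b2b-bsdres`, run/shared/lean/b2b/bsd-rank1-residual/, verbatim in every
file): the goal of the cell is to DELETE the COMBINATION-SHAPED residual classes of the
Birch–Swinnerton-Dyer formula for ALL analytic-rank `≤ 1` elliptic curves over `ℚ` — "full BSD
formula for every rank `≤ 1` curve in class `C`" assembled STRICTLY from published theorems — so
that the rank-`≤ 1` remainder becomes exactly the CONSTRUCTION-SHAPED classes, which are TYPED
(missing-input `Prop`s), NOT attempted. This is not "finishing BSD". Research routes; no claim
beyond the stated classes; nothing booked; no label changes. THEOREMS ONLY (no definition, no named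
fact, no `sorry`); every published theorem enters as one of the tree's existing named Literature
facts BY NAME; every unproved / untyped-in-Literature statement enters as an EXPLICIT binder.

## What this file records (and why the binders `htam` / `hopt` / `htam1` of gens 3–8 disappear)

The MC-level kernel derivation of the covered rank-one irreducible rows C2 (Burungale–Castella–
Skinner 2025 Cor. 1.3.1), C16 (Yan–Zhu 2026 Thm. 4.15) and C3-ordinary (Jetchev–Skinner–Wan 2017
Thm. 1.2.1) of gens 2–8 routed the anticyclotomic input through the ONE-SIDED interface STEP L
(`X11b.IndexLowerBoundAt`: "IMC `⊆` ∘ BDP + control ⇒ `2·ord_p[E(K):ℤP] ≤ ord_p #Ш(E/K) + 2·ord_p ∏c_ℓ`",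
JSW §7.4.1 (eq:shalowerK-1), which in print uses only Wan's divisibility), and therefore needed an
UPPER bound on `#Ш(E/K)` from elsewhere: Kolyvagin's Tamagawa-blind index bound (gens 2–7, proviso
`p ∤ ∏c_ℓ`) or Jetchev's sharpening (gen 8, "optimal curve, at most one Tamagawa number divisible by
`p`"), the remainder being JSW §7.4.2's `K″` / Shimura-curve argument (ask A14). But the anticyclotomic
main conjectures the tree VENDORS for these rows are TWO-SIDED EQUALITIES —
`BurungaleCastellaSkinner2025.thm124b_thm513_generator_constantCoeff` (BCS IMRN 2025 Thm. 1.2.4 (b):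
"`ch(X_Gr(E/K_∞⁻)) = (L_p^{BDP}(E/K))` in `Λ^{ur}`" under (sur), composed with CGLS 2022 Thm. 5.1.3:
`F(0) = u·c_E⁻²(1 − a_p p⁻¹ + p⁻¹)²(log_{ω_E}P_K)²`) and `YanZhu2026.thm412_thm513_generator_constantCoeff`
(Yan–Zhu, J. Algebra 693 (2026) Thm. 4.12 at `p = 3`, same shape) — and with an EQUALITY the
anticyclotomic control theorem (JSW 2017 Thm. 3.3.1, `thm331_anticyclotomicControl`) yields the
Heegner-index IDENTITY over `K` (`X11b.IndexIdentityAt`: `2·ord_p ∏c_ℓ + ord_p #Ш(E/K) = 2·ord_p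
[E(K):ℤP]`) DIRECTLY — gen 3's bookkeeping theorem `X11b.indexIdentityAt_of_onTreeGoodLinks_of_allSplit`
(any prime; the anomaly term cancels, the Tamagawa term over the all-split `K` is `2·ord_p ∏_ℓ c_ℓ(E)`
EXACTLY, JSW (eq:tamK)) — with NO upper bound imported from an Euler-system index argument. This is
literally the printed proof of BCS Cor. 1.3.1 (arXiv:2405.00270v2 p. 4: "By Theorem 1.2.4 … the
`p`-part of the Birch–Swinnerton-Dyer formula for `E/K` … the `r = 0` result for the `K`-quadratic
twist of `E`") and of Yan–Zhu Thm. 4.15 (§4.6), which carry NO Tamagawa hypothesis; JSW need `K″`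
only because §6–§7 of their paper have Wan's ONE divisibility. The equality links were ALREADY in the
tree since gen 6 / gen 7 (`X11b.imcWaldspurgerOnTreeGoodAt_inducedPlace_of_thm124b_of_thm331`,
`X11b.imcWaldspurgerOnTreeGoodAt_inducedPlace_of_thm412_of_thm331`) but were consumed only after
WEAKENING to the one-sided link (`imcLowerWaldspurgerOnTreeGoodAt_of_imcWaldspurgerOnTreeGoodAt`).
This file re-plumbs the class level through the identity:

* §1 `X11b.bsdp_rankOne_of_indexIdentityAt_of_twist_mazurMainConjecture` — at a classical Manin-unit
  Heegner datum: the identity over `K` (binder `hid`) + the twist's typed cyclotomic main conjecture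
  + Greenberg 4.1 + GZ + Kolyvagin (rank one and finiteness over `K` ONLY — NOT the index bound) +
  GZK + modularity ⇒ `BSD(E,p)`; = multr1's descent `X11b.bsdp_of_indexIdentityAt` with the twist's
  rank-`0` `p`-part derived from its main conjecture. No `Surj`, no Tamagawa proviso.
* §2 `bsdp_rankOne_of_identityAt_of_columnMainConjecture` — CLASS level (field by Hoffstein–Luo,
  Manin-unit datum by Mazur, twist transports — gen 2's proof verbatim), typed input `hId` = the
  identity at every admissible datum, granted finiteness of `Ш(E/K)`.
* §3 `bsdp_rankOne_of_thm331_of_columnMainConjecture_odd_of_identityLink` — the same with the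
  control link PUBLISHED (JSW 3.3.1) and the anticyclotomic input asked as the EQUALITY link
  `X11b.IMCWaldspurgerOnTreeGoodAt p κ (inducedPlace ι) γ ι P` (binder `hA`): gen 6's
  `bsdp_rankOne_of_thm331_of_columnMainConjecture_odd` with `hLA ↦ hA` and `hB`, `htam0` GONE.

The row theorems (C2, C16, C3) with `hA` discharged by the two facts, and the all-primes statement of
record WITHOUT any Tamagawa binder, are in the companion files
`MainConjecturesIrreducibleIdentityRows.lean` / `MainConjecturesCoveredAllPrimesIdentity.lean`.

References: [BurungaleCastellaSkinner2025] Thm. 1.1.2 (b), Thm. 1.2.4 (b), Cor. 1.3.1 and its proof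
(arXiv:2405.00270v2 p. 4); [YanZhu2024MainConjNonCM] Thm. 4.9, 4.12, 4.15 (§4.6);
[JetchevSkinnerWan2017] Thm. 3.3.1 with §3.5 (3.5.d), §7.3.1 (eq:tamK), §7.4.1–7.4.2 (arXiv:1512.06894
pp. 30–31); [CastellaGrossiLeeSkinner2022] Thm. 5.1.3; [Castella2018] §5 (5.1)–(5.3);
[GrossLMS1991] Conj. (2.2); [Miller2011LMS] Def. 1.1; HOME/b2b-bsdres-lit-glue/GLUE.md GEN 9 ADDENDUM.
-/

set_option autoImplicit false

noncomputable section

open scoped Classical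

open WeierstrassCurve NumberField IsDedekindDomain Literature.NumberTheory.EllipticCurves
  Literature.NumberTheory.EllipticCurves.ModularForms Literature.NumberTheory.Automorphic
  Literature.NumberTheory.EllipticCurves.Rank1Residual
  Literature.NumberTheory.EllipticCurves.JetchevSkinnerWan2017
  Summit.BirchSwinnertonDyer.BirchSwinnertonDyer.Theorems.Rank1ResidualX1Defs

namespace Summit.BirchSwinnertonDyer.Rank1Residual

namespace X11b

/-! ### §1 The datum theorem, IDENTITY form (no index bound, no Tamagawa proviso) -/

/-- **Rank one at a classical Heegner datum from the Heegner-index IDENTITY over `K`** — gen 2's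
`bsdp_rankOne_of_indexLowerBoundAt_of_twist_mazurMainConjecture` with STEP L `hL`, Kolyvagin's index
bound `hB`, surjectivity and the proviso `p ∤ ∏c_ℓ` REPLACED by the identity itself
(`hid : #Ш(E/K) < ∞ → X11b.IndexIdentityAt W p K P`, the OUTPUT of "two-sided anticyclotomic IMC ∘ BDP
+ anticyclotomic control" at the datum — §3 / companion file). Data: `K` imaginary quadratic with the
Heegner hypothesis for the level `N` and `L(E^{d_K},1) ≠ 0`, `P` the Heegner point of a
parametrisation datum `Dt` with `p ∤ c(Dt)`, `p ∤ #𝓞_K^×`, a globally minimal model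
`Wd = Cd • E^{(d_K)}` good ordinary at `p` with the two decidable transports (`htamd`:
`ord_p ∏c_ℓ(Wd) = ord_p ∏c_ℓ(E)`, `hu`). The pair: `ord_{s=1} L(E,s) = 1`, `p` odd. PUBLISHED inputs
by name: Gross–Zagier (`hGZ`), Kolyvagin (`hKo`: rank one and finite `Ш` over `K` from a non-torsion
Heegner point — NOT the index bound), Greenberg Thm. 4.1 (`hGr`), GZK, modularity. TYPED: the
twist's cyclotomic main conjecture `hMCd` and `hid`. Chain: the twist's rank-`0` `p`-part from its
main conjecture (`padicValRat_bsd_rank_zero_of_mazurMainConjecture`), then multr1's descent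
`bsdp_of_indexIdentityAt` ("the `r = 0` result for the `K`-quadratic twist", BCS Cor. 1.3.1, proof).
[cite: BurungaleCastellaSkinner2025, Cor. 1.3.1 (r = 1), proof (p. 4)]
[cite: GreenbergLNM1716, Thm. 4.1 (p. 102)] [cite: GrossLMS1991, §2 Conj. (2.2)] [cite: Miller2011LMS, Def. 1.1] -/
theorem bsdp_rankOne_of_indexIdentityAt_of_twist_mazurMainConjecture
    (W : WeierstrassCurve ℚ) [W.IsElliptic] [W.IsGloballyMinimal] (p : ℕ) [Fact p.Prime]
    (N : ℕ) [NeZero N] (K : Type) [Field K] [NumberField K]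
    (Dt : ModularParametrizationData W N) (H : HeegnerDatum N (NumberField.discr K)) (ι : K →+* ℂ)
    (P : (W.baseChange K).toAffine.Point)
    -- the published inputs (named facts of the tree)
    (hGZ : gross_zagier N W K) (hKo : kolyvagin N W K) (hGr : greenberg_charValue_rankZero)
    (hGZK : rank_eq_analyticRank_of_analyticRank_le_one) (hmod : hasEntireLFunction_rat)
    (hpar : nonempty_modularParametrizationData)
    -- the pair
    (hr : W.analyticRank = 1) (hp2 : p ≠ 2)
    -- the Heegner data
    (hK : IsImaginaryQuadratic K) (hHN : SatisfiesHeegnerHypothesis N K)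
    (hP : WeierstrassCurve.Affine.Point.map ι.toRatAlgHom P = heegnerPointComplex Dt H)
    (hc : ¬ (p : ℤ) ∣ Dt.c) (hμ : ¬ p ∣ Units.torsionOrder K)
    (hLt : (W.quadraticTwist (NumberField.discr K : ℚ)).entireLFunction 1 ≠ 0)
    -- a globally minimal model of the twist, good ordinary at `p`, the two transports
    (Wd : WeierstrassCurve ℚ) [Wd.IsElliptic] [Wd.IsGloballyMinimal] (Cd : VariableChange ℚ)
    (hWd : Cd • W.quadraticTwist (NumberField.discr K : ℚ) = Wd) (hordd : GoodOrd Wd p)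
    (htamd : padicValNat p Wd.tamagawaProduct = padicValNat p W.tamagawaProduct)
    (hu : padicValRat p (Cd.u : ℚ) = 0)
    -- the typed inputs: the twist's cyclotomic main conjecture and the identity over `K`
    (hMCd : MazurMainConjecture Wd p)
    (hid : Finite (W.baseChange K).sha → IndexIdentityAt W p K P) : BSDp W p := by
  have hD0 : (NumberField.discr K : ℚ) ≠ 0 := by exact_mod_cast NumberField.discr_ne_zero K
  haveI hEt : (W.quadraticTwist (NumberField.discr K : ℚ)).IsElliptic :=
    W.isElliptic_quadraticTwist hD0
  -- the twist: analytic rank `0`, finiteness, and its rank-`0` `p`-part FROM ITS MAIN CONJECTURE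
  have hLt' : (W.quadraticTwist (NumberField.discr K : ℚ)).entireLFunction = Wd.entireLFunction := by
    rw [← hWd, entireLFunction_smul]
  have hLd1 : Wd.entireLFunction 1 ≠ 0 := by rw [← hLt']; exact hLt
  have hfinSd : Finite Wd.sha := (hGZK Wd (by
    rw [(Wd.analyticRank_eq_zero_iff_holds (hmod Wd)).2 hLd1]; exact zero_le_one)).2
  have htw := padicValRat_bsd_rank_zero_of_mazurMainConjecture Wd p hordd.1 hordd.2 hLd1 hfinSd hpar
    (fun κ γ hκ hγ hγ' D _ hX fE hfE hSel ↦
      hGr Wd p hp2 hordd.1 hordd.2 κ γ hκ hγ hγ' D hX fE hfE hSel) hMCd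
  exact bsdp_of_indexIdentityAt W p N K Dt H ι P hGZ hKo hGZK hmod hK hHN hP hp2 hc hμ hr hLt Wd Cd
    hWd htw htamd hu hid

end X11b

/-! ### §2 Rank one at the CLASS level from the identity at every admissible datum -/

/-- **Rank one at the class level from the column's typed cyclotomic main conjecture and the
Heegner-index IDENTITY over the Heegner fields** — gen 2's
`bsdp_rankOne_of_indexLowerBoundAt_of_columnMainConjecture` with STEP L `hL` + Kolyvagin's index
bound `hB` + `p ∤ ∏c_ℓ` REPLACED by ONE typed input `hId`: the identity `X11b.IndexIdentityAt W p K P`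
at every Manin-unit classical Heegner datum of `E` over a field with `d_K` odd `< −4`, every `ℓ ∣ N`
and `p` split, `L(E^{d_K},1) ≠ 0`, GRANTED `#Ш(E/K) < ∞` (what "two-sided anticyclotomic IMC ∘ BDP +
control" outputs — §3). All other binders as in gen 2 / gen 8 §3: published facts `hGZ`, `hKo`, `hGr`,
`hGZK`, `hmod`, `hpar`, `hnf`, `hHL`, `hMaz`, `hNS`; the pair `p ≥ 3` good ordinary, `ρ̄` onto,
`r_an = 1`; the column's typed MC `hMC` and the (im)-witness `hIm` at `p`. NO Tamagawa binder, NO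
optimality binder. Proof = gen 2's: sign `−1` (modularity); field by Hoffstein–Luo (`d_K ≡ 1 mod 8`,
`d_K < −4`, every `ℓ ∣ N` and `p` split, `L(E^{d_K},1) ≠ 0`); `w_K = 2`; `p ∤ d_K`; the Manin-unit
datum at `p ∤ N` (Mazur); a globally minimal model of the twist (Néron) and the transports (good
ordinary: Knapp 12.10; surjectivity; `ord_p ∏c_ℓ`; `ord_p u = 0`); then §1.
[cite: BurungaleCastellaSkinner2025, Cor. 1.3.1 (r = 1), proof (p. 4)] [cite: HoffsteinLuo1997, Theorem (§1)]
[cite: Mazur1978, Cor. 4.1] [cite: Miller2011LMS, Def. 1.1] -/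
theorem bsdp_rankOne_of_identityAt_of_columnMainConjecture
    -- published inputs (named facts of the tree)
    (hGZ : ∀ (N : ℕ) [NeZero N] (W : WeierstrassCurve ℚ) (K : Type) [Field K] [NumberField K],
      gross_zagier N W K)
    (hKo : ∀ (N : ℕ) [NeZero N] (W : WeierstrassCurve ℚ) (K : Type) [Field K] [NumberField K],
      kolyvagin N W K)
    (hGr : greenberg_charValue_rankZero) (hGZK : rank_eq_analyticRank_of_analyticRank_le_one)
    (hmod : hasEntireLFunction_rat) (hpar : nonempty_modularParametrizationData)
    (hnf : exists_isNewformOf) (hHL : HoffsteinLuo1997_exists_twist_L_one_ne_zero)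
    (hMaz : mazur_not_dvd_maninConstant_of_odd) (hNS : integral_neronScaling_of_isGloballyMinimal)
    -- the pair
    (W : WeierstrassCurve ℚ) [W.IsElliptic] [W.IsGloballyMinimal] (p : ℕ) [Fact p.Prime]
    (hp3 : 3 ≤ p) (hord : GoodOrd W p) (hsurj : Surj W p) (hr : W.analyticRank = 1)
    -- the column's typed main conjecture at `p`, and the (im)-from-surj witness at `p`
    (hMC : ∀ (V : WeierstrassCurve ℚ) [V.IsElliptic] [V.IsGloballyMinimal],
      GoodOrd V p → Irr V p → BigIm V p → MazurMainConjecture V p)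
    (hIm : ∀ (V : WeierstrassCurve ℚ) [V.IsElliptic] [V.IsGloballyMinimal],
      GoodOrd V p → Surj V p → BigIm V p)
    -- the typed input: the Heegner-index identity at every Manin-unit Heegner datum over a BCS/YZ field
    (hId : ∀ (N : ℕ) [NeZero N] (K : Type) [Field K] [NumberField K]
      (Dt : ModularParametrizationData W N) (H : HeegnerDatum N (NumberField.discr K)) (ι : K →+* ℂ)
      (P : (W.baseChange K).toAffine.Point),
      W.conductorNorm ℤ = N → IsImaginaryQuadratic K → Odd (NumberField.discr K) →
      NumberField.discr K < -4 → SatisfiesHeegnerHypothesis N K → SatisfiesHeegnerHypothesis p K →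
      (W.quadraticTwist (NumberField.discr K : ℚ)).entireLFunction 1 ≠ 0 →
      WeierstrassCurve.Affine.Point.map ι.toRatAlgHom P = heegnerPointComplex Dt H →
      ¬ (p : ℤ) ∣ Dt.c → Finite (W.baseChange K).sha → X11b.IndexIdentityAt W p K P) :
    BSDp W p := by
  have hpP : p.Prime := Fact.out
  have hp2 : p ≠ 2 := by omega
  have hgood : Good W p := hord.1
  have hirr : Irr W p := irr_of_surj W p hsurj
  haveI : NeZero (W.conductorNorm ℤ) := ⟨(W.conductorNorm_pos_holds).ne'⟩
  -- the sign of the functional equation is `−1` (modularity, `r_an = 1`)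
  have hw : W.rootNumber = -1 := by
    rw [WeierstrassCurve.rootNumber_eq_neg_one_pow_analyticRank_of_exists_isNewformOf hnf W, hr]
    norm_num
  -- the field (Hoffstein–Luo): `d_K ≡ 1 (mod 8)`, `d_K < −4`, every `ℓ ∣ N` and `p` split,
  -- `L(E^{d_K},1) ≠ 0`
  obtain ⟨K, _, _, hK, hodd, hlt, hHN, hHp, hLt⟩ :=
    exists_admissibleField_of_rootNumber_eq_neg_one hnf hHL W hw p
  -- `p ∤ d_K` (`p` splits) and `w_K = 2`, prime to `p`
  have hpd : ¬ (p : ℤ) ∣ NumberField.discr K := not_dvd_discr_of_split hK hpP hp2 hHp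
  have hμ : ¬ p ∣ Units.torsionOrder K := by
    haveI : IsTotallyComplex K := hK.2
    rw [Literature.NumberTheory.DiophantineGeometry.torsionOrder_eq_two_of_discr_lt hK.1 hlt]
    intro h2
    have := Nat.le_of_dvd two_pos h2
    omega
  -- the Manin-unit Heegner datum at the good prime `p`
  obtain ⟨Dt, H, ι, P, hP, hc⟩ :=
    X11b.exists_maninDatum_of_good hnf hMaz hNS W p (W.conductorNorm ℤ) K rfl hp2 hgood hirr hK hHN
  -- a globally minimal model of the twist (Néron) and the transports
  have hD0 : (NumberField.discr K : ℚ) ≠ 0 := by exact_mod_cast NumberField.discr_ne_zero K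
  haveI hEt : (W.quadraticTwist (NumberField.discr K : ℚ)).IsElliptic :=
    W.isElliptic_quadraticTwist hD0
  obtain ⟨Cd, hCd⟩ := hasGlobalMinimalModel_rat_holds (W.quadraticTwist (NumberField.discr K : ℚ))
  haveI : (Cd • W.quadraticTwist (NumberField.discr K : ℚ)).IsGloballyMinimal := hCd
  have hWd : Cd • W.quadraticTwist (NumberField.discr K : ℚ) =
      Cd • W.quadraticTwist (NumberField.discr K : ℚ) := rfl
  have hordd : GoodOrd (Cd • W.quadraticTwist (NumberField.discr K : ℚ)) p :=
    X11b.goodOrd_twist_model W p K hK.1 hp2 hpd hord Cd hWd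
  have hsurjd : Surj (Cd • W.quadraticTwist (NumberField.discr K : ℚ)) p :=
    X11b.surj_twist_model W p K hsurj Cd hWd
  have hirrd : Irr (Cd • W.quadraticTwist (NumberField.discr K : ℚ)) p := irr_of_surj _ p hsurjd
  have himd : BigIm (Cd • W.quadraticTwist (NumberField.discr K : ℚ)) p := hIm _ hordd hsurjd
  have htamd : padicValNat p (Cd • W.quadraticTwist (NumberField.discr K : ℚ)).tamagawaProduct =
      padicValNat p W.tamagawaProduct :=
    X2.padicValNat_tamagawaProduct_twist_of_heegner_of_odd W p hp2 K hK hodd hpd hHN Cd hWd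
  have hu : padicValRat p (Cd.u : ℚ) = 0 :=
    X11b.padicValRat_u_eq_zero_of_twist_good W p hpd hgood Cd hWd hordd.1
  exact X11b.bsdp_rankOne_of_indexIdentityAt_of_twist_mazurMainConjecture W p (W.conductorNorm ℤ) K
    Dt H ι P (hGZ _ W K) (hKo _ W K) hGr hGZK hmod hpar hr hp2 hK hHN hP hc hμ hLt
    (Cd • W.quadraticTwist (NumberField.discr K : ℚ)) Cd hWd hordd htamd hu (hMC _ hordd hirrd himd)
    (hId _ K Dt H ι P rfl hK hodd hlt hHN hHp hLt hP hc)

/-! ### §3 The same with the control link PUBLISHED and the anticyclotomic input asked as the EQUALITY -/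

/-- **Rank one, generic odd prime `p ≥ 3`, anomalous or not, IDENTITY form: the column's typed
cyclotomic main conjecture + Jetchev–Skinner–Wan 2017 Thm. 3.3.1 (PUBLISHED anticyclotomic control)
+ the TWO-SIDED anticyclotomic IMC ∘ BDP link + (irred_K) at the Heegner fields ⇒ `BSD(E,p)` — NO
Tamagawa proviso.** Gen 6's `bsdp_rankOne_of_thm331_of_columnMainConjecture_odd` with the typed
input asked as the EQUALITY `X11b.IMCWaldspurgerOnTreeGoodAt p κ (inducedPlace ι) γ ι P` (JSW /
Castella letter: "`ord_p f(0) = 2·(ord_p log_ω P + ord_p(1 − a_p + p) − 1)`" — the PUBLISHED shape on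
these data: BCS 2025 Thm. 1.2.4 (b) / Yan–Zhu 2026 Thm. 4.12 ∘ Castella 2018 Thm. 3.2 / CGLS 5.1.3;
discharged from the named facts in the companion file) instead of the one-sided `hLA`, and with
Kolyvagin's index bound `hB` and the proviso `htam0 : p ∤ ∏c_ℓ` GONE: at the datum, control
(`X11b.controlOnTreeGoodAt_of_thm331_of_inducedPlace`) + the equality give the identity by gen 3's
`X11b.indexIdentityAt_of_onTreeGoodLinks_of_allSplit`, then §2. The binder `hA` is demanded at
existing data (an anticyclotomic `(κ, γ)` and a degree-one `𝔭 ∣ p` exist, `ι := embAt 𝔭`) and carries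
the facts' own side conditions (`rank_ℤ E(K) = 1`, `#Ш(E/K)[p^∞] < ∞`, `P` non-torsion), which are
DISCHARGED here (GZK for `E` and `E^{d_K}` + the descent lemma
`mordellWeilRank_baseChange_eq_one_and_finite_sha_of_twist_L_one_ne_zero`; Gross–Zagier).
[cite: BurungaleCastellaSkinner2025, Thm. 1.2.4 (b), Cor. 1.3.1 (r = 1) and its proof (p. 4)]
[cite: YanZhu2024MainConjNonCM, Thm. 4.12, Thm. 4.15 (§4.6)]
[cite: JetchevSkinnerWan2017, Thm. 3.3.1 with §3.5 (3.5.d), §7.3.1 (eq:tamK)]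
[cite: Castella2018, §5 (5.1)–(5.3) (arXiv:1704.06608 p. 12)] [cite: Miller2011LMS, Def. 1.1] -/
theorem bsdp_rankOne_of_thm331_of_columnMainConjecture_odd_of_identityLink
    -- published inputs (named facts of the tree)
    (hGZ : ∀ (N : ℕ) [NeZero N] (W : WeierstrassCurve ℚ) (K : Type) [Field K] [NumberField K],
      gross_zagier N W K)
    (hKo : ∀ (N : ℕ) [NeZero N] (W : WeierstrassCurve ℚ) (K : Type) [Field K] [NumberField K],
      kolyvagin N W K)
    (h331 : thm331_anticyclotomicControl)
    (hGr : greenberg_charValue_rankZero) (hGZK : rank_eq_analyticRank_of_analyticRank_le_one)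
    (hmod : hasEntireLFunction_rat) (hpar : nonempty_modularParametrizationData)
    (hnf : exists_isNewformOf) (hHL : HoffsteinLuo1997_exists_twist_L_one_ne_zero)
    (hMaz : mazur_not_dvd_maninConstant_of_odd) (hNS : integral_neronScaling_of_isGloballyMinimal)
    -- the pair (anomalous allowed; NO Tamagawa proviso)
    (W : WeierstrassCurve ℚ) [W.IsElliptic] [W.IsGloballyMinimal] (p : ℕ) [Fact p.Prime]
    (hp3 : 3 ≤ p) (hord : GoodOrd W p) (hsurj : Surj W p) (hr : W.analyticRank = 1)
    -- the column's typed cyclotomic main conjecture at `p`, and the (im)-from-surj witness at `p`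
    (hMC : ∀ (V : WeierstrassCurve ℚ) [V.IsElliptic] [V.IsGloballyMinimal],
      GoodOrd V p → Irr V p → BigIm V p → MazurMainConjecture V p)
    (hIm : ∀ (V : WeierstrassCurve ℚ) [V.IsElliptic] [V.IsGloballyMinimal],
      GoodOrd V p → Surj V p → BigIm V p)
    -- (irred_K) at the imaginary quadratic fields with `p` split — JSW's / BCS's / YZ's hypothesis
    (hIrrK : ∀ (K : Type) [Field K] [NumberField K], IsImaginaryQuadratic K →
      SatisfiesHeegnerHypothesis (W.conductorNorm ℤ) K → SatisfiesHeegnerHypothesis p K →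
      (W.baseChange K).HasIrreducibleModPGaloisRep p)
    -- the TWO-SIDED (IMC∘BDP)ᵍ link at this pair's classical Heegner data, JSW/Castella letter
    (hA : ∀ (N : ℕ) [NeZero N] (K : Type) [Field K] [NumberField K]
      (Dt : ModularParametrizationData W N) (H : HeegnerDatum N (NumberField.discr K)) (ιC : K →+* ℂ)
      (P : (W.baseChange K).toAffine.Point),
      W.conductorNorm ℤ = N → IsImaginaryQuadratic K → Odd (NumberField.discr K) →
      NumberField.discr K < -4 → SatisfiesHeegnerHypothesis N K → SatisfiesHeegnerHypothesis p K →
      (W.quadraticTwist (NumberField.discr K : ℚ)).entireLFunction 1 ≠ 0 →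
      WeierstrassCurve.Affine.Point.map ιC.toRatAlgHom P = heegnerPointComplex Dt H →
      ¬ (p : ℤ) ∣ Dt.c → (W.baseChange K).HasIrreducibleModPGaloisRep p →
      (W.baseChange K).mordellWeilRank = 1 →
      Finite (AddCommGroup.primaryComponent (W.baseChange K).sha p) → ¬ IsOfFinAddOrder P →
      ∀ (κ : ZpExtension K p), κ.IsAnticyclotomic →
        ∀ (γ : Field.absoluteGaloisGroup K) [Fact (κ.IsTopGenerator γ)] (ι : K →+* ℚ_[p]),
          X11b.IMCWaldspurgerOnTreeGoodAt p κ (X11b.inducedPlace ι) γ ι P) :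
    BSDp W p := by
  refine bsdp_rankOne_of_identityAt_of_columnMainConjecture hGZ hKo hGr hGZK hmod hpar hnf hHL hMaz
    hNS W p hp3 hord hsurj hr hMC hIm ?_
  intro N _ K _ _ Dt H ιC P hN hK hodd hlt hHN hHp hLt hP hc hfin
  haveI : Finite (W.baseChange K).sha := hfin
  -- rank one over `K` and `#Ш(E/K)[p^∞] < ∞` (GZK for `E` and the twist, descent), `P_K` non-torsion
  obtain ⟨hrQ, hShaQ⟩ := hGZK W hr.le
  rw [hr] at hrQ
  obtain ⟨hrk, hfinp⟩ :=
    mordellWeilRank_baseChange_eq_one_and_finite_sha_of_twist_L_one_ne_zero hGZK W K hK p hrQ hShaQ hLt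
  have hPinf : ¬ IsOfFinAddOrder P :=
    X11b.not_isOfFinAddOrder_of_heegner_of_analyticRank_eq_one W N K Dt H ιC P (hGZ N W K) hmod hr hK
      hHN hLt hP
  -- (irred_K) at this field
  have hirrK : (W.baseChange K).HasIrreducibleModPGaloisRep p :=
    hIrrK K hK (by rw [hN]; exact hHN) hHp
  -- one anticyclotomic datum `(κ, γ)`, a prime `𝔭 ∣ p`, the embedding at `𝔭`, its induced prime
  obtain ⟨κ, γ, 𝔭, hκ, hγ, h𝔭⟩ := X11b.exists_anticyclotomic_generator_prime (p := p) hK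
  haveI : Fact (κ.IsTopGenerator γ) := ⟨hγ⟩
  have hsplit : X11b.SplitsIn K p := hHp p Fact.out (dvd_refl p)
  obtain ⟨he, hf⟩ := X11b.degreeOne_of_splitsIn hK.1 hsplit h𝔭
  set ι : K →+* ℚ_[p] := X11b.embAt K p 𝔭 h𝔭 he hf with hι
  -- (CTL)ᵍ from JSW 3.3.1 at `(κ, γ, inducedPlace ι, ι)`; the EQUALITY link from `hA`
  have hCTL : X11b.ControlOnTreeGoodAt p κ (X11b.inducedPlace ι) γ ι P :=
    X11b.controlOnTreeGoodAt_of_thm331_of_inducedPlace h331 hp3 hord.1 hK hHp hN hHN hirrK ι κ hκ γ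
      hrk hfinp P hPinf
  have hIW : X11b.IMCWaldspurgerOnTreeGoodAt p κ (X11b.inducedPlace ι) γ ι P :=
    hA N K Dt H ιC P hN hK hodd hlt hHN hHp hLt hP hc hirrK hrk hfinp hPinf κ hκ γ ι
  -- the identity over `K` (any prime; the anomaly term cancels, Tamagawa term exact at all-split `K`)
  exact X11b.indexIdentityAt_of_onTreeGoodLinks_of_allSplit hK hN hHN hIW hCTL

end Summit.BirchSwinnertonDyer.Rank1Residual

end
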